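import Summits.HodgeConjecture.HodgeCM.Automorphic.KernelModelHeisenbergPair_2

/-! PORT of `HodgeCM/Automorphic/KernelModelHeisenbergPair.lean` (HodgeCMPerL run 82) — part 3: continuation of `Summits.HodgeConjecture.HodgeCM.Automorphic.KernelModelHeisenbergPair_2` (split at a top-level declaration boundary by port_pkg.py; scope re-opened below; declarations unchanged). -/

-- port_pkg: scope re-opened for this part (file-level context, then the namespace/section stack open at the cut)
set_option autoImplicit false
noncomputable section
open MeasureTheory Topology
open HodgeCM.PerL34 HodgeCM.PerL34.Annihilation
open scoped RealInnerProductSpace FourierTransform SchwartzMap CompactlySupported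
attribute [-instance] Quotient.instMeasurableSpace
namespace HodgeCM
namespace SchwartzWeil
namespace HeisenbergPair
open HeisenbergKernel
attribute [local instance] borelCircle borelSpace_circle borelT borelSpace_T
section Compact
variable (V : Type) [NormedAddCommGroup V] [InnerProductSpace ℝ V] [FiniteDimensional ℝ V] [MeasurableSpace V]
  [BorelSpace V] (K : Submodule ℝ V) (L₁ : Submodule ℤ K) [DiscreteTopology L₁] [IsZLattice ℝ L₁]
  (L₂ : Submodule ℤ Kᗮ) [DiscreteTopology L₂] [IsZLattice ℝ L₂] (m : ℤ) [NeZero m]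
/-- **Run 24's analytic package `AnalyticU`** (AX5b, AX12, (U), hence AX8 at the regular-representation level) for the dual-pair
model in the Haar model `μ` of `U(W)(𝔸) = Heis Kᗮ`, with NO hypothesis (pv15-g2 `AnalyticK.toAnalyticU`). -/
theorem analyticU : (torusCarrier V K L₁ L₂ m).toRegTorusCarrier.AnalyticU (QH Kᗮ L₂ m).μ :=
  KernelTorusCarrier.AnalyticK.toAnalyticU (QH Kᗮ L₂ m).isCocompactHaarModel (W V K L₁ L₂ m).θ_cont
    (W V K L₁ L₂ m).θ_omg (analyticK V K L₁ L₂ m)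

/-- The same input read as pv06-g3's `CompactTorusModelData` (with `unfold` PROVED) and as pv15-g2's `QuotientTorusDatum` of
the dual-pair model — by name, for consumers of those interfaces. -/
def modelData :=
  (compactInput V K L₁ L₂ m).toModelData (QH Kᗮ L₂ m).isCocompactHaarModel

/-! ### Smoke: every instance hypothesis is met by Mathlib objects

`V = ℝ³` (Euclidean), ANY subspace `K`, `L₁`, `L₂` the `ℤ`-spans of the chosen real bases of `K` and `Kᗮ` (discrete full
lattices by Mathlib's `ZSpan` instances), any weight `m ≠ 0`: both quotients are then Heisenberg nilmanifolds of dimensions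
`2 dim K + 1` and `2 (3 − dim K) + 1`. -/
example (K : Submodule ℝ (EuclideanSpace ℝ (Fin 3))) (m : ℤ) [NeZero m] :
    (torusCarrier (EuclideanSpace ℝ (Fin 3)) K (Submodule.span ℤ (Set.range (Module.finBasis ℝ K)))
      (Submodule.span ℤ (Set.range (Module.finBasis ℝ Kᗮ))) m).AnalyticK :=
  analyticK _ K _ _ m

end Compact

/-! ## 7. The swapped pair `G_U := Heis Kᗮ`, `U(W) := Heis K`: the same kernel serves both theta lifts

The pair is symmetric: exchanging the rôles of the two commuting Heisenberg groups gives a second Weil theta model on the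
SAME datum with the SAME kernel read transposed (`pairModelSwap_θ_swap`), and the torus-side package of §§5–6 runs for it
with pv15-g5's objects at `(K, L₁)` — so BOTH theta lifts of the pair (`[Heis K] ⇆ [Heis Kᗮ]`) carry `AnalyticK` /
`AnalyticU` with no hypothesis (the two directions of the seesaw). -/

section Swap

variable (V : Type) [NormedAddCommGroup V] [InnerProductSpace ℝ V] [FiniteDimensional ℝ V] [MeasurableSpace V]
  [BorelSpace V] (K : Submodule ℝ V) (L₁ : Submodule ℤ K) [DiscreteTopology L₁] (L₂ : Submodule ℤ Kᗮ)
  [DiscreteTopology L₂] (m : ℤ)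

/-- **The swapped dual-pair model** `WeilThetaModel (Heis Kᗮ) (arith Kᗮ L₂ m) (Heis K) (arith K L₁ m)`: same datum
`datumH V (L₁ ⊕ L₂) m`, splitting `(y, x) ↦ incl₁ x · incl₂ y`. -/
def pairModelSwap : HodgeCM.WeilThetaModel (Heis Kᗮ) (arith Kᗮ L₂ m) (Heis K) (arith K L₁ m) where
  W := datumH V (lat V K L₁ L₂) m
  act_one := repCLM_one_apply V m
  theta_act := thetaH_repCLM V (lat V K L₁ L₂) m
  actionContinuous := actionContinuousH V (lat V K L₁ L₂) m
  thetaContinuousInvariant := thetaContinuousInvariantH V (lat V K L₁ L₂) m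
  dist_cont := continuous_thetaH_left V (lat V K L₁ L₂) m 1
  s := (pairSplitting V K).comp (MulEquiv.prodComm : Heis Kᗮ × Heis K ≃* Heis K × Heis Kᗮ).toMonoidHom
  s_cont := (Heis.continuous_pairHom _ _ (inner_coe_coe V K)).comp continuous_swap
  s_rat := fun _ h₂ _ h₁ =>
    (arith V (lat V K L₁ L₂) m).mul_mem (incl₁_mem_arith V K L₁ L₂ m h₁) (incl₂_mem_arith V K L₁ L₂ m h₂)
  SK := Set.univ
  SK_stable := fun _ _ _ => Set.mem_univ _

/-- (Ported verbatim from the HodgeCMPerL package; no docstring in the source.) -/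
@[simp] theorem pairModelSwap_W : (pairModelSwap V K L₁ L₂ m).W = datumH V (lat V K L₁ L₂) m := rfl

/-- (Ported verbatim from the HodgeCMPerL package; no docstring in the source.) -/
@[simp] theorem pairModelSwap_SK : (pairModelSwap V K L₁ L₂ m).SK = Set.univ := rfl

/-- (Ported verbatim from the HodgeCMPerL package; no docstring in the source.) -/
@[simp] theorem pairModelSwap_s_apply (p : Heis Kᗮ × Heis K) :
    (pairModelSwap V K L₁ L₂ m).s p = incl₁ V K p.2 * incl₂ V K p.1 := rfl

/-- `ω^{swap}(x)Φ = ρ_m(incl₁ x)Φ` for `x ∈ Heis K`. -/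
theorem pairModelSwap_omg (x : Heis K) (Φ : (pairModelSwap V K L₁ L₂ m).SK) :
    ((pairModelSwap V K L₁ L₂ m).omg x Φ).1 = repCLM V m (incl₁ V K x) Φ.1 := by
  have h1 : (pairModelSwap V K L₁ L₂ m).s (1, x) = incl₁ V K x := by
    rw [pairModelSwap_s_apply, map_one, mul_one]
  rw [WeilThetaModel.coe_omg, h1]
  exact datumH_act V (lat V K L₁ L₂) m _ Φ.1

/-- (Ported verbatim from the HodgeCMPerL package; no docstring in the source.) -/
theorem pairModelSwap_θ_mk (Φ : 𝓢(V, ℂ)) (y : Heis Kᗮ) (x : Heis K) :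
    (pairModelSwap V K L₁ L₂ m).θ ⟨Φ, Set.mem_univ Φ⟩ (QuotientGroup.mk y, QuotientGroup.mk x) =
      thetaH V (lat V K L₁ L₂) m Φ (incl₁ V K x⁻¹ * incl₂ V K y⁻¹) := by
  rw [WeilThetaModel.θ_mk]
  rfl

/-- **The swapped model's kernel is the transposed kernel**: `θ^{swap}_Φ(yΓ₂, xΓ₁) = θ_Φ(xΓ₁, yΓ₂)`. -/
theorem pairModelSwap_θ_swap (Φ : 𝓢(V, ℂ)) (x : Heis K) (y : Heis Kᗮ) :
    (pairModelSwap V K L₁ L₂ m).θ ⟨Φ, Set.mem_univ Φ⟩ (QuotientGroup.mk y, QuotientGroup.mk x) =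
      (pairModel V K L₁ L₂ m).θ ⟨Φ, Set.mem_univ Φ⟩ (QuotientGroup.mk x, QuotientGroup.mk y) := by
  rw [pairModelSwap_θ_mk, pairModel_θ_mk]

/-- The swapped kernel along the Schrödinger torus of `Heis K` at the origin of `[Heis Kᗮ]`:
`θ^{swap}_Φ(1, (jT(a, u))⁻¹Γ₁) = uᵐ Σ_{v ∈ L} Φ(v − a)`, `a ∈ K`. -/
theorem pairModelSwap_θ_one_torus (Φ : 𝓢(V, ℂ)) (t : Multiplicative K × Circle) :
    (pairModelSwap V K L₁ L₂ m).θ ⟨Φ, Set.mem_univ Φ⟩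
        (QuotientGroup.mk 1, QuotientGroup.mk (Heis.ofSchrodinger t)⁻¹) =
      (t.2 : ℂ) ^ m * ∑' v : lat V K L₁ L₂, Φ ((v : V) - ((Multiplicative.toAdd t.1 : K) : V)) := by
  rw [pairModelSwap_θ_mk, inv_inv, inv_one, map_one, mul_one, thetaH_eq]
  simp only [incl₁_a, incl₁_b, incl₁_u, Heis.ofSchrodinger_a, Heis.ofSchrodinger_b, Heis.ofSchrodinger_u,
    Submodule.coe_zero, smul_zero, inner_zero_left, AddChar.map_zero_eq_one, Circle.coe_one, one_mul]

variable [IsZLattice ℝ L₁] [IsZLattice ℝ L₂] [NeZero m]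

/-- The swapped model over the quotient models. -/
abbrev Wswap : WeilThetaModel (QH Kᗮ L₂ m).G (QH Kᗮ L₂ m).Γ (QH K L₁ m).G (QH K L₁ m).Γ :=
  pairModelSwap V K L₁ L₂ m

/-- The kernel core carrier of the swapped model (`[G_U] = Heis Kᗮ ⧸ arith Kᗮ L₂ m` now). -/
abbrev coreSwap :=
  KernelModel.core (QH Kᗮ L₂ m) (QH K L₁ m) (Wswap V K L₁ L₂ m).SK (Wswap V K L₁ L₂ m).omg (Wswap V K L₁ L₂ m).θ

/-- (Ported verbatim from the HodgeCMPerL package; no docstring in the source.) -/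
theorem structural_swap :
    (∀ Φ, (coreSwap V K L₁ L₂ m).omg 1 Φ = Φ) ∧ Continuous (coreSwap V K L₁ L₂ m).θ ∧
      ∀ (h : (QH K L₁ m).G) Φ ξ (q : (QH K L₁ m).G ⧸ (QH K L₁ m).Γ),
        (coreSwap V K L₁ L₂ m).θ ((coreSwap V K L₁ L₂ m).omg h Φ) (ξ, q) =
          (coreSwap V K L₁ L₂ m).θ Φ (ξ, h⁻¹ • q) :=
  (Wswap V K L₁ L₂ m).structural_laws

/-- AX1b(a) for the nilmanifold `Heis Kᗮ ⧸ arith Kᗮ L₂ m`. -/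
theorem hatτ_complete_swap : (⨆ j, (coreSwap V K L₁ L₂ m).hatτ j).topologicalClosure = ⊤ :=
  KernelModel.core_hatτ_complete (QH Kᗮ L₂ m) (QH K L₁ m) _ _ _

/-- The torus-side carrier of the swapped model: pv15-g5's §3 objects at `(K, L₁)`. -/
def torusCarrierSwap : KernelTorusCarrier (coreSwap V K L₁ L₂ m) (Multiplicative K × Circle) where
  X := Xw K L₁ m
  allowed := fun _ => True
  Tι := Circle
  torus := ⇑((jT K).toMonoidHom.comp (MonoidHom.inr (Multiplicative K) Circle))
  w := ⇑(weightC m)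
  ν := Measure.haar
  jT := jT K
  β := β K L₁ m
  χv := fun χ => ⟨fun t => dualChar χ.1 (QuotientGroup.mk t), (continuous_dualChar χ.1).comp QuotientGroup.continuous_mk⟩

/-- (Ported verbatim from the HodgeCMPerL package; no docstring in the source.) -/
theorem torusCarrierSwap_ν : (torusCarrierSwap V K L₁ L₂ m).ν = Measure.haar := rfl

/-- (Ported verbatim from the HodgeCMPerL package; no docstring in the source.) -/
instance isHaarMeasure_ν_swap : (torusCarrierSwap V K L₁ L₂ m).ν.IsHaarMeasure := by
  rw [torusCarrierSwap_ν]; infer_instance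
/-- (Ported verbatim from the HodgeCMPerL package; no docstring in the source.) -/
instance isFiniteMeasureOnCompacts_ν_swap : IsFiniteMeasureOnCompacts (torusCarrierSwap V K L₁ L₂ m).ν :=
  inferInstance
/-- (Ported verbatim from the HodgeCMPerL package; no docstring in the source.) -/
instance isOpenPosMeasure_ν_swap : (torusCarrierSwap V K L₁ L₂ m).ν.IsOpenPosMeasure := inferInstance
/-- (Ported verbatim from the HodgeCMPerL package; no docstring in the source.) -/
instance isMulRightInvariant_ν_swap : (torusCarrierSwap V K L₁ L₂ m).ν.IsMulRightInvariant := inferInstance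

/-- AX5b for the swapped model. -/
theorem AX5b_swap (χ : Xw K L₁ m) : Continuous ((torusCarrierSwap V K L₁ L₂ m).ϑc χ) :=
  (torusCarrierSwap V K L₁ L₂ m).AX5b_holds (Wswap V K L₁ L₂ m).θ_cont χ

/-- The compact-quotient input of the swapped model, constructed (pv15-g5's §4 at `(K, L₁)`). -/
def compactInputSwap : (torusCarrierSwap V K L₁ L₂ m).CompactInput where
  Λ := ΛT K L₁ m
  instΛ₂ := isClosed_ΛT K L₁ m
  exists_fd := by
    obtain ⟨F, -, hF, -, hfin⟩ :=
      DiscreteFD.exists_isFundamentalDomain_op_finite (ΛT K L₁ m) (torusCarrierSwap V K L₁ L₂ m).ν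
    exact ⟨F, hF, hfin⟩
  jT_Λ := fun _ ht => ht
  β_sum := β_sum K L₁ m
  Tc := Circle
  μ := haarCircle
  ιc := MonoidHom.inr (Multiplicative K) Circle
  ιc_cont := (Continuous.prodMk_right 1 : Continuous fun u : Circle => ((1 : Multiplicative K), u))
  w := weightC m
  w_cont := continuous_weightC m
  w_norm := norm_weightC m
  Ew_eq := rfl
  emb := fun χ => χ.1
  emb_spec := fun _ _ => rfl
  emb_surj := fun ξ hξ => ⟨⟨ξ, hξ⟩, rfl⟩
  Gf := Multiplicative K
  ιf := modHom K
  comm := fun b u => modHom_mul_ofSchrodinger_one K b u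
  dense := fun h => subset_closure ⟨1, one_mem _, (Multiplicative.ofAdd h.a, h.u * 𝐞 ⟪h.a, h.b⟫),
    Multiplicative.ofAdd h.b, by rw [one_mul]; exact eq_ofSchrodinger_mul_modHom K h⟩

/-- **AX8 for the swapped model (the other theta lift of the pair), with NO hypothesis.** -/
theorem analyticK_swap : (torusCarrierSwap V K L₁ L₂ m).AnalyticK :=
  (torusCarrierSwap V K L₁ L₂ m).analyticK_of_compactInput (QH K L₁ m).isCocompactHaarModel
    (hatτ_complete_swap V K L₁ L₂ m) (compactInputSwap V K L₁ L₂ m)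

/-- … and run 24's `AnalyticU` for it. -/
theorem analyticU_swap : (torusCarrierSwap V K L₁ L₂ m).toRegTorusCarrier.AnalyticU (QH K L₁ m).μ :=
  KernelTorusCarrier.AnalyticK.toAnalyticU (QH K L₁ m).isCocompactHaarModel (Wswap V K L₁ L₂ m).θ_cont
    (Wswap V K L₁ L₂ m).θ_omg (analyticK_swap V K L₁ L₂ m)

end Swap

end HeisenbergPair

end SchwartzWeil
end HodgeCM

end
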